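import Summits.Parity.GeneralizedHardyLittlewood.Theorems.LeeYangFibresCellParityLawInductionDefs
import Summits.Parity.GeneralizedHardyLittlewood.Theorems.LeeYangFibresCellParityLawKernelInductionAux
import Summits.Parity.GeneralizedHardyLittlewood.Theorems.LeeYangFibresCellParityLawKernelInductionStep
import HarnessLib

/-!
# Route `LeeYangFibres`, crux `CellParityLaw` (stmt-Parity-14109), line `section-annihilator`:
# the induction `KernelInduction` (skeleton v19) — the base `m = 1` (`stub_inductionBaseOne`)

The explicit-parameter cell law `Q(m) = CellLawAt m` (`…InductionDefs`) at `m = 1`: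

  `|C₁(𝒜; x, z) − (1 + (δ* − 1)(−1)^1) I_1(u') T(𝒜; x, z)| ≤ kernelErr C κ A₂ 𝒜 x z η Λ R`,

`C₁ = roughCellSum 𝒜 x z 1` (the primes of the sequence in `(z, x]`), `T = primeMain 𝒜 x z`,
`u' = log x/log z ≥ 2` (so `I_1(u') = 1`, `roughCellDensity_one_of_one_le`), `δ* = cellDelta 𝒜 x z
= max 0 (2 − C₁/T)`. Since `(1 + (δ* − 1)(−1)) T = (2 − δ*) T`, the clipping identity
`|C₁ − (2 − δ*) T| ≤ max 0 (C₁ − 2T)` (`StepAux.clip_defect_le`; it needs `0 ≤ C₁ ≤ A(x)`, `T ≥ 0` and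
`T = 0 → C₁ = 0`, which hold because `V(z) > 0` and `u' > 0`) reduces `Q(1)` to the linear-sieve upper bound
`C₁ ≤ 2T + kernelErr` (`PrimeUpperBound`, the hypothesis). The output exponent is `κ := min κ 1` and the output
range `η₀ := min η₀ 1` (so that `η ≤ 1`), the currency being antitone in `κ` (`KernelErrAux.kernelErr_mono`) once
`x ≥ exp (2(u+1))` forces `log z ≥ 2`, `log x ≥ 6`.

References: E. Bombieri, RIMS Kôkyûroku 294 (1977) p. 5 [BombieriRIMS1977].
-/

noncomputable section

open scoped BigOperators Classical
open Finset Literature.NumberTheory.Sieve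

namespace Summit.Parity.GeneralizedHardyLittlewood.Cruxes.CellParityLaw.SectionAnnihilator

/-- **`stub_inductionBaseOne`** (registered sub-goal of `stub_kernelInduction`, skeleton v19, line
`section-annihilator`): the base `m = 1` of the induction, `PrimeUpperBound → CellLawAt 1` — the clipping
identity `|C₁ − (2 − δ*) T| ≤ max 0 (C₁ − 2T)` behind `δ* = max 0 (2 − C₁/T)` plus the linear-sieve upper bound
`C₁ ≤ 2T + kernelErr` (`I_1(u') = 1` as `u' = log x/log z ≥ 2`). -/
theorem stub_inductionBaseOne : InductionBaseOne := by
  intro hPUB u A₁ L' hu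
  obtain ⟨κU, CU, η₀U, A₂U, x₀U, hκU, hCU, hη₀U, hPU⟩ := hPUB u A₁ L' hu
  have hu2 : (2 : ℝ) ≤ u := by exact_mod_cast hu
  have hu10 : (0 : ℝ) < (u : ℝ) + 1 := by linarith
  refine ⟨min κU 1, CU, min η₀U 1, A₂U, max x₀U (Real.exp (2 * ((u : ℝ) + 1))),
    lt_min hκU one_pos, min_le_right _ _, hCU, lt_min hη₀U one_pos, ?_⟩
  intro 𝒜 x z η Λ w₀ R hx₀ hzlo hzhi hKR hKA
  obtain ⟨hηlo, hηhi, hΛ1, hΛhi, hw₀2, hw₀hi⟩ := hKR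
  -- the upper bound, at the wider range `η ≤ η₀U`
  have hKR' : KernelRanges x η Λ w₀ η₀U :=
    ⟨hηlo, hηhi.trans (min_le_left _ _), hΛ1, hΛhi, hw₀2, hw₀hi⟩
  have hP := hPU 𝒜 x z η Λ w₀ R ((le_max_left _ _).trans hx₀) hzlo hzhi hKR' hKA
  obtain ⟨-, -, -, hsize, -, hdim, -, hTypeI⟩ := hKA
  rw [StrongTypeI] at hTypeI
  /- 1. ranges of `x`, `z`, `η`, `Λ` -/
  have hxe : Real.exp (2 * ((u : ℝ) + 1)) ≤ x := (le_max_right _ _).trans hx₀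
  have hx0 : 0 < x := (Real.exp_pos _).trans_le hxe
  have hlxge : 2 * ((u : ℝ) + 1) ≤ Real.log x := by
    rw [Real.le_log_iff_exp_le hx0]
    exact hxe
  have hlx6 : 6 ≤ Real.log x := by linarith
  have hlx0 : 0 < Real.log x := by linarith
  have hz0 : 0 < z := (Real.rpow_pos_of_pos hx0 _).trans_le hzlo
  have hlzlo : Real.log x / ((u : ℝ) + 1) ≤ Real.log z := by
    have h := Real.log_le_log (Real.rpow_pos_of_pos hx0 _) hzlo
    rw [Real.log_rpow hx0] at h
    calc Real.log x / ((u : ℝ) + 1) = 1 / ((u : ℝ) + 1) * Real.log x := by ring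
      _ ≤ Real.log z := h
  have hlzhi : Real.log z ≤ Real.log x / 2 := by
    have h := Real.log_le_log hz0 hzhi
    rw [Real.log_rpow hx0] at h
    linarith
  have hlz2 : 2 ≤ Real.log z := by
    refine le_trans ?_ hlzlo
    rw [le_div_iff₀ hu10]
    linarith
  have hlz0 : 0 < Real.log z := by linarith
  have hez : Real.exp 1 ≤ z := (Real.le_log_iff_exp_le hz0).mp (by linarith)
  have hex : Real.exp 1 ≤ x := (Real.le_log_iff_exp_le hx0).mp (by linarith)
  have he1 : 1 < Real.exp 1 := Real.one_lt_exp_iff.mpr one_pos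
  have hz1 : 1 < z := he1.trans_le hez
  have hx1 : 1 ≤ x := (he1.trans_le hex).le
  -- `u' = log x / log z ≥ 2`
  have hu'2 : 2 ≤ Real.log x / Real.log z := by
    rw [le_div_iff₀ hlz0]
    linarith
  have hu'0 : 0 < Real.log x / Real.log z := by linarith
  -- `η`, `Λ`
  have hη0 : 0 < η := (Real.rpow_pos_of_pos hlx0 _).trans_le hηlo
  have hη1 : η ≤ 1 := hηhi.trans (min_le_right _ _)
  have hΛ : 1 / 2 ≤ Λ := by linarith
  /- 2. sizes: `V(z) > 0`, `0 ≤ C₁ ≤ A(x)`, `R ≥ 0`, `T ≥ 0`, `T = 0 → C₁ = 0` -/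
  have hV0 : 0 < 𝒜.densityProduct (primesProdBelow z) := hdim.densityProduct_pos z
  obtain ⟨hC10, hC1A⟩ := StepAux.roughCellSum_le_size 𝒜 x z 1 hsize
  have hA0 : 0 ≤ 𝒜.size x := hC10.trans hC1A
  have hR0 : 0 ≤ R :=
    le_trans (Finset.sum_nonneg fun _ _ => abs_nonneg _) (hTypeI (fun _ => x) fun _ => le_rfl)
  have hT0 : 0 ≤ primeMain 𝒜 x z := by
    unfold primeMain
    positivity
  have hTC : primeMain 𝒜 x z = 0 → roughCellSum 𝒜 x z 1 = 0 := by
    intro h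
    by_contra hne
    have hApos : 0 < 𝒜.size x := (lt_of_le_of_ne hC10 (Ne.symm hne)).trans_le hC1A
    have hTpos : 0 < primeMain 𝒜 x z := by
      unfold primeMain
      positivity
    linarith
  /- 3. clipping and the upper bound -/
  have hclip := (StepAux.clip_defect_le hC10 hT0 hTC).2.2
  have hmodel : (1 + (cellDelta 𝒜 x z - 1) * (-1 : ℝ) ^ 1) *
      roughCellDensity 1 (Real.log x / Real.log z) * primeMain 𝒜 x z =
      (2 - max 0 (2 - roughCellSum 𝒜 x z 1 / primeMain 𝒜 x z)) * primeMain 𝒜 x z := by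
    rw [roughCellDensity_one_of_one_le (by linarith : (1 : ℝ) ≤ Real.log x / Real.log z)]
    unfold cellDelta
    ring
  rw [hmodel]
  have hE0 : 0 ≤ kernelErr CU κU A₂U 𝒜 x z η Λ R :=
    KernelErrAux.kernelErr_nonneg hCU hη0.le hΛ hz1 hx1 hV0.le hA0 hR0
  calc |roughCellSum 𝒜 x z 1 - (2 - max 0 (2 - roughCellSum 𝒜 x z 1 / primeMain 𝒜 x z)) * primeMain 𝒜 x z|
      ≤ max 0 (roughCellSum 𝒜 x z 1 - 2 * primeMain 𝒜 x z) := hclip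
    _ ≤ kernelErr CU κU A₂U 𝒜 x z η Λ R := max_le hE0 (by linarith)
    _ ≤ kernelErr CU (min κU 1) A₂U 𝒜 x z η Λ R :=
        KernelErrAux.kernelErr_mono hCU le_rfl (lt_min hκU one_pos) (min_le_left _ _) le_rfl
          hη0.le hη1 hΛ hez hex hV0.le hA0 hR0

end Summit.Parity.GeneralizedHardyLittlewood.Cruxes.CellParityLaw.SectionAnnihilator

end
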